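import Literature.Geometry.Lorentzian.DevelopmentGluingData
import Literature.Geometry.Lorentzian.CauchyDevelopmentIsometryClasses
import Literature.Geometry.Lorentzian.OpensCausality
import HarnessLib

/-!
# The symmetry of common globally hyperbolic developments: `(ψ(U), ψ⁻¹)` is a common development
# of `M'` and `M` (Sbierski 2016, Remark 3 (2) and "the other inclusion follows by symmetry")

J. Sbierski, *On the existence of a maximal Cauchy development for the Einstein equations: a
dezornification*, Ann. Henri Poincaré 17 (2016) 301–329 = arXiv:1309.7591v3, §2, Remark 3:
*"while Definition (PreDefCGHD) is symmetric in `M` and `M'`, i.e., `U` being a CGHD of `M` and `M'`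
is the same as `U` being a CGHD of `M'` and `M`, the symmetry is broken in Definition (DefCGHD)"* —
in which a common globally hyperbolic development is REALISED as an open subset `U ⊆ M` together
with its time-orientation preserving isometric immersion `ψ : U → M'` (the tree's
`CauchyDevelopment.CommonDevelopment 𝒟 𝒟'`, file `DevelopmentGluingData`). The symmetry is
restored by transport: `ψ` is an open embedding (Lemma 9, `isOpenEmbedding_map`), so
`(ψ(U) ⊆ M', ψ⁻¹ : ψ(U) → M)` is a common globally hyperbolic development of `M'` and `M`
realised in `M'`. This is used silently throughout §3.2, every time an argument made in `M` is
invoked in `M'`: Prop. 13 (*"The other inclusion follows by symmetry"*), Lemma 14 (the extension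
`ψ̂` and the set `C` of corresponding boundary points seen from `M'`), and the final gluing.

* `CommonDevelopment.rangeOpens` — `ψ(U)` as an open subset of `M'`; `CommonDevelopment.symmMap`
  — `ψ⁻¹ : ψ(U) → M` (the inverse gluing map `glue.symm` on `ψ(U)`), smooth
  (`contMDiff_symmMap`), with `dψ ∘ dψ⁻¹ = id` (`mfderiv_map_mfderiv_glue_symm`), an isometric
  immersion (`val_mfderiv_glue_symm`) reflecting future-directedness
  (`isFutureDirected_mfderiv_glue_symm`);
* `CommonDevelopment.isCauchyHypersurface_rangeOpens` — **`ι'(X)` is a Cauchy hypersurface of the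
  open sub-spacetime `ψ(U)` of `M'`**: an endless timelike curve of `ψ(U)` is carried by `ψ⁻¹` to an
  endless timelike curve of `U` (isometry; endpoints would be carried back by `ψ`), which meets
  `ι(X)` exactly once, and `ψ ∘ ι = ι'`;
* `CommonDevelopment.symm : CommonDevelopment 𝒟 𝒟' → CommonDevelopment 𝒟' 𝒟` — the displayed
  statement, with `symm_opens`, `symm_map`.

Everything is proved; the definitions (`rangeOpens`, `symmMap`, `symm`) have bodies; no named
facts (D-0026).

## References

* J. Sbierski, Ann. Henri Poincaré 17 (2016) 301–329 = arXiv:1309.7591v3, §2 Remark 3, §3.1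
  Lemma 9, §3.2 Prop. 13 and Lemma 14 (arXiv numbering). [Sbierski2016AHP]
* B. O'Neill, *Semi-Riemannian geometry with applications to relativity*, Academic Press 1983,
  Ch. 3, pp. 58, 90–91 (inverse of an isometry), Ch. 5, p. 145 (timecones). [ONeillSemiRiemannian1983]
-/

noncomputable section

open Bundle Set Function Filter TopologicalSpace Topology Manifold
open scoped Manifold ContDiff Topology

namespace Literature.Geometry.Lorentzian

universe u

section Developments

variable {n : ℕ} {X : Type u} [TopologicalSpace X] [ChartedSpace (EuclideanSpace ℝ (Fin n)) X]
  [IsManifold (𝓡 n) ∞ X] [ConnectedSpace X] {D : InitialDataSet (𝓡 n) X}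

namespace CauchyDevelopment.CommonDevelopment

variable {𝒟 𝒟' : CauchyDevelopment D} (𝔠 : CommonDevelopment 𝒟 𝒟')

/-! ### `ψ(U)` and `ψ⁻¹` -/

/-- **`ψ(U)` as an open subset of `M'`** (`ψ` is an open embedding, Sbierski's Lemma 9).
[cite: Sbierski2016AHP, §3.1, Lemma 9 (arXiv numbering)] -/
def rangeOpens : Opens 𝒟'.carrier :=
  ⟨range 𝔠.map, 𝔠.isOpenEmbedding_map.isOpen_range⟩

/-- The carrier of `rangeOpens` is `ψ(U)`. [folklore] -/
@[simp]
theorem coe_rangeOpens : (𝔠.rangeOpens : Set 𝒟'.carrier) = range 𝔠.map := rfl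

/-- Membership in `rangeOpens`. [folklore] -/
theorem mem_rangeOpens_iff {z : 𝒟'.carrier} : z ∈ 𝔠.rangeOpens ↔ z ∈ range 𝔠.map := Iff.rfl

/-- The gluing map is a differentiable open partial homeomorphism (smooth on `U`, smooth inverse on
`ψ(U)`). [cite: Sbierski2016AHP, §3.3, proof of Thm. 5 ("smooth diffeomorphisms")] -/
theorem mdifferentiable_glue : 𝔠.glue.MDifferentiable (𝓡 (n + 1)) (𝓡 (n + 1)) :=
  ⟨𝔠.contMDiffOn_glue.mdifferentiableOn (by simp), 𝔠.contMDiffOn_glue_symm.mdifferentiableOn (by simp)⟩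

/-- `ψ⁻¹(z) ∈ U` for `z ∈ ψ(U)`. [folklore] -/
theorem glue_symm_mem_opens {z : 𝒟'.carrier} (hz : z ∈ range 𝔠.map) : 𝔠.glue.symm z ∈ 𝔠.opens := by
  have h := 𝔠.glue.map_target (x := z) (by rw [glue_target]; exact hz)
  rwa [glue_source] at h

/-- `ψ (ψ⁻¹ z) = z` for `z ∈ ψ(U)`. [folklore] -/
theorem map_glue_symm {z : 𝒟'.carrier} (hz : z ∈ range 𝔠.map) :
    𝔠.map ⟨𝔠.glue.symm z, 𝔠.glue_symm_mem_opens hz⟩ = z := by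
  rw [← 𝔠.glue_apply]
  exact 𝔠.glue.right_inv (by rw [glue_target]; exact hz)

/-- The inverse gluing map is smooth at the points of `ψ(U)`. [cite: Sbierski2016AHP, §3.3, proof of Thm. 5 ("smooth diffeomorphisms")] -/
theorem contMDiffAt_glue_symm {z : 𝒟'.carrier} (hz : z ∈ range 𝔠.map) :
    ContMDiffAt (𝓡 (n + 1)) (𝓡 (n + 1)) ∞ 𝔠.glue.symm z :=
  𝔠.contMDiffOn_glue_symm.contMDiffAt (𝔠.glue.open_target.mem_nhds (by rw [glue_target]; exact hz))

/-- **`dψ ∘ dψ⁻¹ = id`** at `ψ y`. [folklore] -/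
theorem mfderiv_map_mfderiv_glue_symm (y : 𝔠.opens)
    (u : TangentSpace (𝓡 (n + 1)) (𝔠.map y)) :
    mfderiv (𝓡 (n + 1)) (𝓡 (n + 1)) 𝔠.map y
      (mfderiv (𝓡 (n + 1)) (𝓡 (n + 1)) 𝔠.glue.symm (𝔠.map y) u) = u := by
  have h := 𝔠.mdifferentiable_glue.comp_symm_deriv (x := 𝔠.map y)
    (by rw [glue_target]; exact ⟨y, rfl⟩)
  have h' : mfderiv (𝓡 (n + 1)) (𝓡 (n + 1)) 𝔠.glue (𝔠.glue.symm (𝔠.map y))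
      (mfderiv (𝓡 (n + 1)) (𝓡 (n + 1)) 𝔠.glue.symm (𝔠.map y) u) = u :=
    DFunLike.congr_fun h u
  have hpt : 𝔠.glue.symm (𝔠.map y) = y := 𝔠.glue_symm_apply_map y
  have hgen : ∀ p : 𝒟.carrier, p = (y : 𝒟.carrier) →
      mfderiv (𝓡 (n + 1)) (𝓡 (n + 1)) 𝔠.glue p
        (mfderiv (𝓡 (n + 1)) (𝓡 (n + 1)) 𝔠.glue.symm (𝔠.map y) u) = u →
      mfderiv (𝓡 (n + 1)) (𝓡 (n + 1)) 𝔠.map y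
        (mfderiv (𝓡 (n + 1)) (𝓡 (n + 1)) 𝔠.glue.symm (𝔠.map y) u) = u := by
    rintro p rfl hp
    rwa [𝔠.mfderiv_glue_eq] at hp
  exact hgen _ hpt h'

/-- **`ψ⁻¹` is isometric**: `g(dψ⁻¹ u, dψ⁻¹ w) = g'(u, w)` at `ψ y` (`ψ` is an isometric
immersion and `dψ dψ⁻¹ = id`; O'Neill 1983, Ch. 3, p. 58). [cite: ONeillSemiRiemannian1983, Ch. 3, p. 58] -/
theorem val_mfderiv_glue_symm (y : 𝔠.opens) (u w : TangentSpace (𝓡 (n + 1)) (𝔠.map y)) :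
    𝒟.metric.val y (mfderiv (𝓡 (n + 1)) (𝓡 (n + 1)) 𝔠.glue.symm (𝔠.map y) u)
        (mfderiv (𝓡 (n + 1)) (𝓡 (n + 1)) 𝔠.glue.symm (𝔠.map y) w) =
      𝒟'.metric.val (𝔠.map y) u w := by
  have key : ∀ a b : TangentSpace (𝓡 (n + 1)) y,
      𝒟'.metric.val (𝔠.map y) (mfderiv (𝓡 (n + 1)) (𝓡 (n + 1)) 𝔠.map y a)
        (mfderiv (𝓡 (n + 1)) (𝓡 (n + 1)) 𝔠.map y b) = 𝒟.metric.val y a b := fun a b ↦ by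
    exact congrArg (fun β ↦ β a b) (𝔠.isIsometricImmersion.2 y)
  rw [← key, mfderiv_map_mfderiv_glue_symm, mfderiv_map_mfderiv_glue_symm]

/-- The same at a general point `z ∈ ψ(U)`. [cite: ONeillSemiRiemannian1983, Ch. 3, p. 58] -/
theorem val_mfderiv_glue_symm' {z : 𝒟'.carrier} (hz : z ∈ range 𝔠.map)
    (u w : TangentSpace (𝓡 (n + 1)) z) :
    𝒟.metric.val (𝔠.glue.symm z) (mfderiv (𝓡 (n + 1)) (𝓡 (n + 1)) 𝔠.glue.symm z u)
        (mfderiv (𝓡 (n + 1)) (𝓡 (n + 1)) 𝔠.glue.symm z w) = 𝒟'.metric.val z u w := by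
  obtain ⟨y, rfl⟩ := hz
  have hpt : 𝔠.glue.symm (𝔠.map y) = y := 𝔠.glue_symm_apply_map y
  have hgen : ∀ p : 𝒟.carrier, p = (y : 𝒟.carrier) →
      𝒟.metric.val p (mfderiv (𝓡 (n + 1)) (𝓡 (n + 1)) 𝔠.glue.symm (𝔠.map y) u)
        (mfderiv (𝓡 (n + 1)) (𝓡 (n + 1)) 𝔠.glue.symm (𝔠.map y) w) =
      𝒟'.metric.val (𝔠.map y) u w := by
    rintro p rfl
    exact 𝔠.val_mfderiv_glue_symm y u w
  exact hgen _ hpt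

/-- **`ψ⁻¹` reflects future-directedness**: if `u` is future-directed at `z = ψ y` then `dψ⁻¹ u` is
future-directed at `y` (`dψ (dψ⁻¹ u) = u` and the converse timecone lemma
`PreservesTimeOrientation.isFutureDirected_of_mfderiv`; O'Neill 1983, Ch. 5, p. 145).
[cite: ONeillSemiRiemannian1983, Ch. 5, p. 145] -/
theorem isFutureDirected_mfderiv_glue_symm {z : 𝒟'.carrier} (hz : z ∈ range 𝔠.map)
    {u : TangentSpace (𝓡 (n + 1)) z} (hu : 𝒟'.timeOrientation.IsFutureDirected u) :
    𝒟.timeOrientation.IsFutureDirected (x := 𝔠.glue.symm z)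
      (mfderiv (𝓡 (n + 1)) (𝓡 (n + 1)) 𝔠.glue.symm z u) := by
  obtain ⟨y, rfl⟩ := hz
  have hpt : 𝔠.glue.symm (𝔠.map y) = y := 𝔠.glue_symm_apply_map y
  have h : (𝒟.timeOrientation.restrict PseudoRiemannianMetric.contMDiff_restrict_holds
      𝒟.timeOrientation.contMDiff_restrict_holds 𝔠.opens).IsFutureDirected (x := y)
      (mfderiv (𝓡 (n + 1)) (𝓡 (n + 1)) 𝔠.glue.symm (𝔠.map y) u) :=
    TimeOrientation.PreservesTimeOrientation.isFutureDirected_of_mfderiv 𝔠.preservesTimeOrientation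
      𝔠.isIsometricImmersion.2 (by rw [mfderiv_map_mfderiv_glue_symm]; exact hu)
  have hgen : ∀ p : 𝒟.carrier, p = (y : 𝒟.carrier) →
      𝒟.timeOrientation.IsFutureDirected (x := p)
        (mfderiv (𝓡 (n + 1)) (𝓡 (n + 1)) 𝔠.glue.symm (𝔠.map y) u) := by
    rintro p rfl
    exact h
  exact hgen _ hpt

/-- **`ψ⁻¹ : ψ(U) → M`**, the inverse gluing map on the open subset `ψ(U)` of `M'`.
[cite: Sbierski2016AHP, §2, Remark 3 (2) (arXiv numbering)] -/
def symmMap : 𝔠.rangeOpens → 𝒟.carrier := fun z ↦ 𝔠.glue.symm z.1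

/-- Unfolding lemma for `symmMap`. [folklore] -/
theorem symmMap_apply (z : 𝔠.rangeOpens) : 𝔠.symmMap z = 𝔠.glue.symm z.1 := rfl

/-- `ψ⁻¹` takes values in `U`. [folklore] -/
theorem symmMap_mem (z : 𝔠.rangeOpens) : 𝔠.symmMap z ∈ 𝔠.opens := 𝔠.glue_symm_mem_opens z.2

/-- `ψ⁻¹ (ψ y) = y`. [folklore] -/
theorem symmMap_map (y : 𝔠.opens) : 𝔠.symmMap ⟨𝔠.map y, y, rfl⟩ = y := 𝔠.glue_symm_apply_map y

/-- `ψ (ψ⁻¹ z) = z`. [folklore] -/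
theorem map_symmMap (z : 𝔠.rangeOpens) : 𝔠.map ⟨𝔠.symmMap z, 𝔠.symmMap_mem z⟩ = z.1 :=
  𝔠.map_glue_symm z.2

/-- `ψ⁻¹` is smooth. [cite: Sbierski2016AHP, §3.3, proof of Thm. 5 ("smooth diffeomorphisms")] -/
theorem contMDiff_symmMap : ContMDiff (𝓡 (n + 1)) (𝓡 (n + 1)) ∞ 𝔠.symmMap := fun z ↦
  (𝔠.contMDiffAt_glue_symm z.2).comp z contMDiff_subtype_val.contMDiffAt

/-- The differential of `ψ⁻¹` on the open submanifold `ψ(U)` is that of `glue.symm`. [folklore] -/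
theorem mfderiv_symmMap (z : 𝔠.rangeOpens) :
    mfderiv (𝓡 (n + 1)) (𝓡 (n + 1)) 𝔠.symmMap z =
      mfderiv (𝓡 (n + 1)) (𝓡 (n + 1)) 𝔠.glue.symm z.1 :=
  mfderiv_comp_subtypeVal ((𝔠.contMDiffAt_glue_symm z.2).mdifferentiableAt (by simp))

/-! ### `ι'(X)` is a Cauchy hypersurface of `ψ(U)` -/

/-- **`ι'(X)` is a Cauchy hypersurface of the open sub-spacetime `ψ(U)` of `M'`.** An endless
timelike curve `γ'` of `(ψ(U), g'|, τ'|)` is carried by `ψ⁻¹` to a timelike curve `δ` of `U`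
(`ψ⁻¹` is an isometry reflecting future-directedness), endless in `U` (an endpoint `q` of `δ` would
make `ψ q ∈ ψ(U)` an endpoint of `γ'`); so `δ` meets the Cauchy hypersurface `ι(X)` of `U` exactly
once, and `ψ` matches the crossings since `ψ ∘ ι = ι'` and `ψ` is injective.
[cite: Sbierski2016AHP, §2, Remark 3 (2) and §3.1 Lemma 9 (arXiv numbering)] -/
theorem isCauchyHypersurface_rangeOpens :
    (𝒟'.metric.restrict PseudoRiemannianMetric.contMDiff_restrict_holds 𝔠.rangeOpens).IsCauchyHypersurface
      (𝒟'.timeOrientation.restrict PseudoRiemannianMetric.contMDiff_restrict_holds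
        𝒟'.timeOrientation.contMDiff_restrict_holds 𝔠.rangeOpens)
      (Subtype.val ⁻¹' range 𝒟'.embed) := by
  intro γ' s hγ'
  obtain ⟨hs, hγt, hγf, hγp⟩ := hγ'
  have hκ : 𝒟'.metric.IsFutureTimelikeCurveOn 𝒟'.timeOrientation (Subtype.val ∘ γ') s :=
    (LorentzianMetric.isFutureTimelikeCurveOn_restrict_iff _ _ _ _ _).1 hγt
  -- the lift `δ = ψ⁻¹ ∘ γ'`, a curve of `U`
  set δ : ℝ → 𝔠.opens := fun t ↦ ⟨𝔠.glue.symm (γ' t).1, 𝔠.glue_symm_mem_opens (γ' t).2⟩ with hδ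
  have hmapδ : ∀ t, 𝔠.map (δ t) = (γ' t).1 := fun t ↦ 𝔠.map_glue_symm (γ' t).2
  have hδval : (Subtype.val ∘ δ) = 𝔠.glue.symm ∘ (Subtype.val ∘ γ') := rfl
  -- `δ` is a future timelike curve of `M`
  have hδM : 𝒟.metric.IsFutureTimelikeCurveOn 𝒟.timeOrientation (Subtype.val ∘ δ) s := by
    intro t ht
    obtain ⟨hd, h1, h2⟩ := hκ t ht
    have hsm : MDifferentiableAt (𝓡 (n + 1)) (𝓡 (n + 1)) 𝔠.glue.symm ((Subtype.val ∘ γ') t) :=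
      (𝔠.contMDiffAt_glue_symm (γ' t).2).mdifferentiableAt (by simp)
    have hdδ : MDifferentiableAt 𝓘(ℝ, ℝ) (𝓡 (n + 1)) (Subtype.val ∘ δ) t := by
      rw [hδval]
      exact hsm.comp t hd
    have hvel : velocity (𝓡 (n + 1)) (Subtype.val ∘ δ) t =
        mfderiv (𝓡 (n + 1)) (𝓡 (n + 1)) 𝔠.glue.symm (γ' t).1
          (velocity (𝓡 (n + 1)) (Subtype.val ∘ γ') t) := by
      change mfderiv 𝓘(ℝ, ℝ) (𝓡 (n + 1)) (𝔠.glue.symm ∘ (Subtype.val ∘ γ')) t (1 : ℝ) = _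
      rw [mfderiv_comp t hsm hd]
      rfl
    refine ⟨hdδ, ?_, ?_⟩
    · change 𝒟.metric.val (𝔠.glue.symm (γ' t).1) (velocity (𝓡 (n + 1)) (Subtype.val ∘ δ) t)
        (velocity (𝓡 (n + 1)) (Subtype.val ∘ δ) t) < 0
      rw [hvel, 𝔠.val_mfderiv_glue_symm' (γ' t).2]
      exact h1
    · change 𝒟.timeOrientation.IsFutureDirected (x := 𝔠.glue.symm (γ' t).1)
        (velocity (𝓡 (n + 1)) (Subtype.val ∘ δ) t)
      rw [hvel]
      exact 𝔠.isFutureDirected_mfderiv_glue_symm (γ' t).2 h2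
  have hδU : (𝒟.metric.restrict PseudoRiemannianMetric.contMDiff_restrict_holds 𝔠.opens).IsFutureTimelikeCurveOn
      (𝒟.timeOrientation.restrict PseudoRiemannianMetric.contMDiff_restrict_holds
        𝒟.timeOrientation.contMDiff_restrict_holds 𝔠.opens) δ s :=
    (LorentzianMetric.isFutureTimelikeCurveOn_restrict_iff _ _ _ _ _).2 hδM
  -- `δ` is endless in `U`
  have hδf : IsFutureEndless δ s := by
    refine ⟨hγf.1, fun q hq ↦ ?_⟩
    have h1 : HasFutureEndpoint (𝔠.map ∘ δ) s (𝔠.map q) := (𝔠.contMDiff_map.continuous.tendsto q).comp hq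
    have h2 : HasFutureEndpoint (Subtype.val ∘ γ') s (𝔠.map q) := h1.congr fun t ↦ hmapδ t
    exact hγf.2 ⟨𝔠.map q, q, rfl⟩ (hasFutureEndpoint_subtypeVal_comp_iff.1 h2)
  have hδp : IsPastEndless δ s := by
    refine ⟨hγp.1, fun q hq ↦ ?_⟩
    have h1 : HasPastEndpoint (𝔠.map ∘ δ) s (𝔠.map q) := (𝔠.contMDiff_map.continuous.tendsto q).comp hq
    have h2 : HasPastEndpoint (Subtype.val ∘ γ') s (𝔠.map q) := h1.congr fun t ↦ hmapδ t
    exact hγp.2 ⟨𝔠.map q, q, rfl⟩ (hasPastEndpoint_subtypeVal_comp_iff.1 h2)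
  -- it meets `ι(X)` exactly once
  obtain ⟨t₀, ⟨ht₀s, ht₀S⟩, huniq⟩ := 𝔠.isCauchyHypersurface δ s ⟨hs, hδU, hδf, hδp⟩
  refine ⟨t₀, ⟨ht₀s, ?_⟩, fun t ht ↦ huniq t ⟨ht.1, ?_⟩⟩
  · -- `γ' t₀ = ψ (δ t₀) = ψ (ι x) = ι' x`
    obtain ⟨x, hx⟩ := ht₀S
    have hδx : δ t₀ = 𝒟.embedOpens 𝔠.opens 𝔠.embed_mem x := Subtype.ext hx.symm
    show (γ' t₀).1 ∈ range 𝒟'.embed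
    rw [← hmapδ t₀, hδx, 𝔠.map_embedOpens]
    exact ⟨x, rfl⟩
  · -- `γ' t = ι' x = ψ (ι x)`, so `δ t = ι x`
    obtain ⟨x, hx⟩ := ht.2
    show (δ t).1 ∈ range 𝒟.embed
    refine ⟨x, ?_⟩
    change 𝒟.embed x = 𝔠.glue.symm (γ' t).1
    rw [← hx, ← 𝔠.map_embedOpens x, 𝔠.glue_symm_apply_map]
    rfl

/-! ### The symmetric common development -/

/-- **The symmetric common development `(ψ(U), ψ⁻¹)` of `𝒟'` and `𝒟`** (Sbierski 2016, §2,
Remark 3: the realised definition breaks the symmetry of "common globally hyperbolic development",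
which is restored by transporting along the open isometric embedding `ψ`): `ψ(U) ⊆ M'` contains
`ι'(X) = ψ(ι(X))`, has `ι'(X)` as a Cauchy hypersurface (`isCauchyHypersurface_rangeOpens`), and
`ψ⁻¹` is a smooth, time-orientation preserving isometric immersion with `ψ⁻¹ ∘ ι' = ι`.
[cite: Sbierski2016AHP, §2, Remark 3 (2) (arXiv numbering)] -/
def symm : CommonDevelopment 𝒟' 𝒟 where
  opens := 𝔠.rangeOpens
  embed_mem x := ⟨𝒟.embedOpens 𝔠.opens 𝔠.embed_mem x, 𝔠.map_embedOpens x⟩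
  isCauchyHypersurface := 𝔠.isCauchyHypersurface_rangeOpens
  map := 𝔠.symmMap
  isIsometricImmersion := by
    refine ⟨𝔠.contMDiff_symmMap, fun z ↦ ?_⟩
    ext u w
    rw [pullbackBilin_apply, 𝔠.mfderiv_symmMap]
    exact 𝔠.val_mfderiv_glue_symm' z.2 u w
  preservesTimeOrientation z := by
    rw [𝔠.mfderiv_symmMap]
    exact 𝔠.isFutureDirected_mfderiv_glue_symm z.2 (𝒟'.timeOrientation.isFutureDirected_vectorField z.1)
  map_comp_embedOpens := by
    funext x
    change 𝔠.glue.symm (𝒟'.embed x) = 𝒟.embed x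
    rw [← 𝔠.map_embedOpens x, 𝔠.glue_symm_apply_map]
    rfl

/-- The open subset of the symmetric common development is `ψ(U)`. [folklore] -/
@[simp]
theorem symm_opens : 𝔠.symm.opens = 𝔠.rangeOpens := rfl

/-- The map of the symmetric common development is `ψ⁻¹`. [folklore] -/
@[simp]
theorem symm_map : 𝔠.symm.map = 𝔠.symmMap := rfl

/-- `ψ⁻¹ ∘ ψ = id` on `U`: the map of `𝔠.symm` inverts `ψ`. [folklore] -/
theorem symm_map_map (y : 𝔠.opens) : 𝔠.symm.map ⟨𝔠.map y, y, rfl⟩ = y := 𝔠.symmMap_map y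

end CauchyDevelopment.CommonDevelopment

end Developments

end Literature.Geometry.Lorentzian

end
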